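import Literature.RingTheory.Flat.IdealDescent
import Literature.AlgebraicGeometry.Resolution.StalkIdealLemmas
import Literature.AlgebraicGeometry.Resolution.AlterationsNormalFormBlowupFormal
import Mathlib.AlgebraicGeometry.Morphisms.Flat
import HarnessLib

/-!
# Descent of ideal sheaves along flat morphisms, stalkwise (fpqc descent of closed subschemes)

Topic: `Literature/AlgebraicGeometry/Resolution`. Let `e : V → X` be a FLAT morphism of schemes
and `K` a quasi-coherent ideal sheaf on `V` (Mathlib `Scheme.IdealSheafData`) carrying a descent
datum relative to `e`: `pr₁^* K = pr₂^* K` on `V ×_X V`. Grothendieck's fpqc descent (SGA 1 VIII;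
The Stacks Project, Tags 023N, 0245) says `K = e^* J` for a unique quasi-coherent ideal `J` of the
image. This file proves the STALKWISE content, which is what the construction of the descended
ideal sheaf needs (file `IdealSheafFlatDescent` of the ÉTALE KATO programme, block EK-5):

* `stalkIdeal_eq_map_comap_of_descent` — at every `v ∈ V`, the stalk `K_v ⊆ 𝒪_{V,v}` is
  EXTENDED from `𝒪_{X, e v}`: `K_v = (K_v ∩ 𝒪_{X,e v}) · 𝒪_{V,v}` (ring form of descent,
  `Literature.RingTheory.Flat.Ideal.eq_map_comap_of_map_includeLeft_le`, applied to the flat local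
  ring map `e_v^*`; the ring-level datum `K_v ⊗ 𝒪_v = 𝒪_v ⊗ K_v` in `𝒪_v ⊗_{𝒪_x} 𝒪_v` is the
  sheaf datum pulled back along `Spec (𝒪_v ⊗_{𝒪_x} 𝒪_v) → V ×_X V`);
* `comap_stalkIdeal_eq_of_descent` — the contracted ideals `K_v ∩ 𝒪_{X,x}` do not depend on the
  point `v` over `x`, and more generally agree for two flat `V₁, V₂ → X` with ideal sheaves
  identified on `V₁ ×_X V₂` (through a point of the fibre product over `(v₁, v₂)` and faithful
  flatness of `𝒪_{V₁,v₁} → 𝒪_{V₁ ×_X V₂, w}`).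

References: [StacksProject] Tags 023N, 0245; A. Grothendieck, SGA 1, Exp. VIII, Thm. 1.1, Cor. 1.9.
-/

noncomputable section

open CategoryTheory CategoryTheory.Limits AlgebraicGeometry TopologicalSpace TensorProduct

namespace Literature.AlgebraicGeometry.Resolution

universe u

section Stalk

variable {V X : Scheme.{u}} (e : V ⟶ X)

/-- **The ring-level descent datum at a point.** For `e : V → X`, an ideal sheaf `K` on `V` with
`pr₁^* K = pr₂^* K` on `V ×_X V`, and `v ∈ V`: with `𝒪_v = 𝒪_{V,v}` an `𝒪_x = 𝒪_{X,e v}`-algebra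
through `e_v^*`, the two extensions of `K_v` to `𝒪_v ⊗_{𝒪_x} 𝒪_v` coincide (pull the sheaf datum
back along `Spec (𝒪_v ⊗ 𝒪_v) → V ×_X V`, the morphism induced by `Spec 𝒪_v → V` twice).
[cite: StacksProject, Tag 023N] -/
theorem map_includeLeft_stalkIdeal_eq_of_descent (K : V.IdealSheafData)
    (hK : K.comap (pullback.fst e e) = K.comap (pullback.snd e e)) (v : V) :
    letI := (e.stalkMap v).hom.toAlgebra
    (stalkIdeal K v).map (Algebra.TensorProduct.includeLeft :
        V.presheaf.stalk v →ₐ[X.presheaf.stalk (e.base v)]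
          V.presheaf.stalk v ⊗[X.presheaf.stalk (e.base v)] V.presheaf.stalk v) =
      (stalkIdeal K v).map (Algebra.TensorProduct.includeRight :
        V.presheaf.stalk v →ₐ[X.presheaf.stalk (e.base v)]
          V.presheaf.stalk v ⊗[X.presheaf.stalk (e.base v)] V.presheaf.stalk v) := by
  letI := (e.stalkMap v).hom.toAlgebra
  -- the two coprojections as ring maps
  let iL : (V.presheaf.stalk v : Type u) →+*
      (V.presheaf.stalk v : Type u) ⊗[X.presheaf.stalk (e.base v)] (V.presheaf.stalk v : Type u) :=
    (Algebra.TensorProduct.includeLeft : V.presheaf.stalk v →ₐ[X.presheaf.stalk (e.base v)]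
      V.presheaf.stalk v ⊗[X.presheaf.stalk (e.base v)] V.presheaf.stalk v).toRingHom
  let iR : (V.presheaf.stalk v : Type u) →+*
      (V.presheaf.stalk v : Type u) ⊗[X.presheaf.stalk (e.base v)] (V.presheaf.stalk v : Type u) :=
    (Algebra.TensorProduct.includeRight : V.presheaf.stalk v →ₐ[X.presheaf.stalk (e.base v)]
      V.presheaf.stalk v ⊗[X.presheaf.stalk (e.base v)] V.presheaf.stalk v).toRingHom
  -- the two morphisms `Spec (𝒪_v ⊗ 𝒪_v) → V` and their agreement over `X`
  have hLR : e.stalkMap v ≫ CommRingCat.ofHom iL = e.stalkMap v ≫ CommRingCat.ofHom iR := by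
    ext r
    change iL (algebraMap (X.presheaf.stalk (e.base v)) (V.presheaf.stalk v) r) =
      iR (algebraMap (X.presheaf.stalk (e.base v)) (V.presheaf.stalk v) r)
    exact RingHom.congr_fun (Algebra.TensorProduct.includeLeftRingHom_comp_algebraMap
      (R := X.presheaf.stalk (e.base v)) (A := (V.presheaf.stalk v : Type u))
      (B := (V.presheaf.stalk v : Type u))) r
  have hab : (Spec.map (CommRingCat.ofHom iL) ≫ V.fromSpecStalk v) ≫ e =
      (Spec.map (CommRingCat.ofHom iR) ≫ V.fromSpecStalk v) ≫ e := by
    have h1 := congrArg (fun φ => Spec.map φ ≫ X.fromSpecStalk (e.base v)) hLR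
    simp only [Spec.map_comp, Category.assoc] at h1
    rw [Category.assoc, Category.assoc, ← Scheme.SpecMap_stalkMap_fromSpecStalk e (x := v)]
    exact h1
  -- pull the sheaf datum back along the induced morphism to the fibre product
  have h := congrArg (fun L : (pullback e e).IdealSheafData =>
    L.comap (pullback.lift _ _ hab)) hK
  simp only [← Scheme.IdealSheafData.comap_comp, pullback.lift_fst, pullback.lift_snd] at h
  -- both sides are ideal sheaves of an affine scheme: compare the top ideals
  rw [comap_SpecMap_comp_fromSpecStalk_eq_ofIdealTop,
    comap_SpecMap_comp_fromSpecStalk_eq_ofIdealTop] at h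
  have h' := congrArg (fun L => Scheme.IdealSheafData.ideal L ⟨⊤, isAffineOpen_top _⟩) h
  simp only [ideal_ofIdealTop_top, CommRingCat.hom_ofHom] at h'
  -- strip the isomorphism `𝒪_v ⊗ 𝒪_v ≅ Γ(Spec (𝒪_v ⊗ 𝒪_v), ⊤)`
  have hb : Function.Bijective (Scheme.ΓSpecIso (CommRingCat.of ((V.presheaf.stalk v : Type u)
      ⊗[X.presheaf.stalk (e.base v)] (V.presheaf.stalk v : Type u)))).inv.hom :=
    ConcreteCategory.bijective_of_isIso _
  have h'' := congrArg (fun I => Ideal.comap (Scheme.ΓSpecIso (CommRingCat.of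
    ((V.presheaf.stalk v : Type u) ⊗[X.presheaf.stalk (e.base v)] (V.presheaf.stalk v : Type u)))).inv.hom I) h'
  simp only [Ideal.comap_map_of_bijective _ hb] at h''
  exact h''

/-- **Stalkwise descent of an ideal sheaf along a flat morphism.** For `e : V → X` flat, an ideal
sheaf `K` on `V` with descent datum `pr₁^* K = pr₂^* K` on `V ×_X V`, and `v ∈ V`: the stalk `K_v`
is extended from `𝒪_{X, e v}` — `K_v = (e_v^*)(e_v^{*-1} K_v) · 𝒪_{V,v}`, i.e. `K_v` is generated
by the image of its contraction to `𝒪_{X,e v}` (ring form of fpqc descent,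
`Literature.RingTheory.Flat.Ideal.eq_map_comap_of_map_includeLeft_le`, for the flat local map
`e_v^* : 𝒪_{X,e v} → 𝒪_{V,v}`). [cite: StacksProject, Tag 0245] -/
theorem stalkIdeal_eq_map_comap_of_descent [Flat e] (K : V.IdealSheafData)
    (hK : K.comap (pullback.fst e e) = K.comap (pullback.snd e e)) (v : V) :
    stalkIdeal K v = ((stalkIdeal K v).comap (e.stalkMap v).hom).map (e.stalkMap v).hom := by
  letI := (e.stalkMap v).hom.toAlgebra
  haveI : Module.Flat (X.presheaf.stalk (e.base v)) (V.presheaf.stalk v) := Flat.stalkMap e v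
  exact Literature.RingTheory.Flat.Ideal.eq_map_comap_of_map_includeLeft_le (stalkIdeal K v)
    (map_includeLeft_stalkIdeal_eq_of_descent e K hK v).le

end Stalk

/-! ## The contracted ideal does not depend on the point over `x` -/

section Independence

variable {V₁ V₂ X : Scheme.{u}} (e₁ : V₁ ⟶ X) (e₂ : V₂ ⟶ X) [Flat e₂]

/-- **Independence of the contraction.** Let `e₁ : V₁ → X`, `e₂ : V₂ → X` with `e₂` flat, and
ideal sheaves `K₁, K₂` identified on the fibre product: `pr₁^* K₁ = pr₂^* K₂` on `V₁ ×_X V₂`. Then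
for points `v₁, v₂` over the same `x ∈ X` the contractions agree:
`e₁^{*-1}(K₁)_{v₁} = e₂^{*-1}(K₂)_{v₂}` in `𝒪_{X,x}`. Proof: through a point `w` of `V₁ ×_X V₂`
over `(v₁, v₂)` (`Scheme.Pullback.exists_preimage_pullback`): both contractions are the
contraction of `(pr₁^*K₁)_w = (pr₂^*K₂)_w` along `𝒪_{X,x} → 𝒪_w`, because
`𝒪_{V₁,v₁} → 𝒪_{V₁ ×_X V₂, w}` is flat local, hence faithfully flat, so
`((K₁)_{v₁} 𝒪_w) ∩ 𝒪_{v₁} = (K₁)_{v₁}` (and symmetrically, using flatness of `pr₂`'s source map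
when `e₁` is flat — here only the `v₁` side needs `pr₁ = ` base change of the flat `e₂`).
[cite: StacksProject, Tag 023N] -/
theorem comap_stalkIdeal_eq_of_descent [Flat e₁] (K₁ : V₁.IdealSheafData) (K₂ : V₂.IdealSheafData)
    (hK : K₁.comap (pullback.fst e₁ e₂) = K₂.comap (pullback.snd e₁ e₂)) (v₁ : V₁) (v₂ : V₂)
    (h : e₁.base v₁ = e₂.base v₂) :
    (stalkIdeal K₁ v₁).comap (e₁.stalkMap v₁).hom =
      ((stalkIdeal K₂ v₂).comap (e₂.stalkMap v₂).hom).comap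
        (X.presheaf.stalkCongr (.of_eq h)).hom.hom := by
  obtain ⟨w, hw₁, hw₂⟩ := Scheme.Pullback.exists_preimage_pullback v₁ v₂ h
  -- faithful flatness of the local maps `𝒪_{p y} → 𝒪_y` of a flat `p`
  have hff : ∀ {Y Z : Scheme.{u}} (p : Y ⟶ Z) [Flat p] (y : Y)
      (I : Ideal (Z.presheaf.stalk (p.base y))),
      (I.map (p.stalkMap y).hom).comap (p.stalkMap y).hom = I := by
    intro Y Z p _ y I
    letI := (p.stalkMap y).hom.toAlgebra
    haveI : Module.Flat (Z.presheaf.stalk (p.base y)) (Y.presheaf.stalk y) := Flat.stalkMap p y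
    haveI : IsLocalHom (algebraMap (Z.presheaf.stalk (p.base y)) (Y.presheaf.stalk y)) :=
      inferInstanceAs (IsLocalHom (p.stalkMap y).hom)
    haveI : Module.FaithfullyFlat (Z.presheaf.stalk (p.base y)) (Y.presheaf.stalk y) :=
      Module.FaithfullyFlat.of_flat_of_isLocalHom
    exact Ideal.comap_map_eq_self_of_faithfullyFlat I
  -- contraction along a composite stalk map
  have hcomp : ∀ {Y Z W : Scheme.{u}} (p : Y ⟶ Z) (q : Z ⟶ W) (y : Y)
      (I : Ideal (Y.presheaf.stalk y)),
      (I.comap (p.stalkMap y).hom).comap (q.stalkMap (p.base y)).hom =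
        I.comap ((p ≫ q).stalkMap y).hom := by
    intro Y Z W p q y I
    rw [Ideal.comap_comap]
    have hc : (p.stalkMap y).hom.comp (q.stalkMap (p.base y)).hom = ((p ≫ q).stalkMap y).hom := by
      rw [Scheme.Hom.stalkMap_comp]; rfl
    rw [hc]
    rfl
  subst hw₁ hw₂
  have E1 : (stalkIdeal K₁ (pullback.fst e₁ e₂ w)).comap (e₁.stalkMap (pullback.fst e₁ e₂ w)).hom =
      (stalkIdeal (K₁.comap (pullback.fst e₁ e₂)) w).comap
        ((pullback.fst e₁ e₂ ≫ e₁).stalkMap w).hom := by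
    rw [stalkIdeal_comap_eq_map_stalkMap, ← hcomp, hff]
  have E2 : (stalkIdeal K₂ (pullback.snd e₁ e₂ w)).comap (e₂.stalkMap (pullback.snd e₁ e₂ w)).hom =
      (stalkIdeal (K₂.comap (pullback.snd e₁ e₂)) w).comap
        ((pullback.snd e₁ e₂ ≫ e₂).stalkMap w).hom := by
    rw [stalkIdeal_comap_eq_map_stalkMap, ← hcomp, hff]
  rw [E1, E2, hK]
  have hc := congrArg CommRingCat.Hom.hom
    (Scheme.Hom.stalkMap_congr_hom _ _ (pullback.condition (f := e₁) (g := e₂)) w)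
  rw [hc]
  rfl

end Independence

end Literature.AlgebraicGeometry.Resolution

end
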